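import Mathlib
import Summits.KontsevichZagierPeriods.KontsevichZagierPeriods.Theorems.SoloInformedLegendreArcsine
import Literature.NumberTheory.Transcendental.KZBetaChains
import Literature.NumberTheory.Transcendental.KZDominatedFamilyRelations
import HarnessLib
import HarnessLib.Audit

/-!
# SoloInformed — Legendre relation XII: the Gauss transformation and the exact term of the second kind

Solo-informed residency (s33), file XII of the Legendre chain — the two analytic inputs of
LANDEN'S TRANSFORMATION OF THE SECOND KIND in `P` (THEOREM XX, file XIII):

* (`soloInformed_gauss_transformation_move`) GAUSS'S TRANSFORMATION `y = (1+k)x/(1+kx²)` (rule 2)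
  maps `(0,1)` onto `(0,1)` with `1 − y² = (1−x²)(1−k²x²)/(1+kx²)²`,
  `1 − k₁²y² = (1−kx²)²/(1+kx²)²` (`k₁² = 4k/(1+k)²`), `dy = (1+k)(1−kx²)dx/(1+kx²)²`; it carries
  `[(0,1), (1+k)(1−kx²)²/((1+kx²)²Δ)]` (`Δ = √(1−x²)√(1−k²x²)`) onto `E(k₁)`;
* (`soloInformed_landenE_exact`) the EXACT TERM: with
  `N(x) = 1 − (2+k+2k²)x² + 3k²x⁴ + k³x⁶` one has `N/(√((1−x²)(1−k²x²))·(1+kx²)²) = F'`,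
  `F = x√((1−x²)(1−k²x²))/(1+kx²)`, `F(0) = F(1) = 0`, so `[(0,1), N/(√P(1+kx²)²)] ∼ 0` by ONE
  Newton–Leibniz move over the point (rule 3) and two null modifications.

Together with the partial-fraction identity
`(1+k)(1−kx²)²/(1+kx²)² = (2/(1+k))(1−k²x²) − (1−k) + (2k/(1+k))·N/(1+kx²)²` these give
`E(k₁) = (2E(k) − k'²K(k))/(1+k)` in `P` (file XIII).

References: C. F. Gauss, *Werke* III 352–353; A. Cayley, *Elliptic Functions* (1895) ch. XIII;
Whittaker–Watson § 22.42; this work (s23 lift lemma, s33).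
-/

noncomputable section

open MeasureTheory Set Filter
open scoped Classical

open Literature.NumberTheory.Transcendental Literature.NumberTheory.Transcendental.KZ
open Literature.ModelTheory.ExponentialFields

namespace Summit.KontsevichZagierPeriods.KontsevichZagierPeriods.Theorems

/-! ### Gauss's transformation `y = (1+k)x/(1+kx²)` -/

/-- Gauss's transformation maps `(0,1)` into `(0,1)`: `0 < (1+k)x/(1+kx²) < 1` for
`0 < x < 1`, `0 < k < 1` (`1 + kx² − (1+k)x = (1−x)(1−kx) > 0`). [folklore] -/
theorem soloInformed_gauss_transformation_mem {k x : ℝ} (hk : k ∈ Ioo (0:ℝ) 1)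
    (hx : x ∈ Ioo (0:ℝ) 1) : (1 + k) * x / (1 + k * x ^ 2) ∈ Ioo (0:ℝ) 1 := by
  have hden : 0 < 1 + k * x ^ 2 := by nlinarith [hk.1, sq_nonneg x]
  refine ⟨div_pos (by nlinarith [hk.1, hx.1]) hden, (div_lt_one hden).2 ?_⟩
  nlinarith [mul_pos (sub_pos.2 hx.2) (show 0 < 1 - k * x by nlinarith [hk.2, hx.2, hk.1, hx.1])]

/-- **The Gauss-transformation move (second kind).** For real algebraic `0 < k < 1` the
substitution `y = (1+k)x/(1+kx²)` (rule 2) carries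
`R = [(0,1), (1+k)(1−kx²)²(1+kx²)^{-2}((1−x²)(1−k²x²))^{-1/2}]` onto
`E(k₁) = [(0,1), (1−k₁²y²)((1−y²)(1−k₁²y²))^{-1/2}]`, `k₁² = 4k/(1+k)²`. [Gauss; this work] -/
theorem soloInformed_gauss_transformation_move (k : ℝ) (hk : k ∈ Ioo (0:ℝ) 1)
    (hka : IsAlgebraic ℚ k) (R E₁ : IntegralRep 1)
    (hRd : R.domain = {x : Fin 1 → ℝ | x 0 ∈ Ioo (0:ℝ) 1})
    (hRi : ∀ x, R.integrand x = (1 + k) * (1 - k * x 0 ^ 2) ^ 2 / (1 + k * x 0 ^ 2) ^ 2 *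
      ((√(1 - x 0 ^ 2))⁻¹ * (√(1 - k ^ 2 * x 0 ^ 2))⁻¹))
    (hE₁d : E₁.domain = {x : Fin 1 → ℝ | x 0 ∈ Ioo (0:ℝ) 1})
    (hE₁i : EqOn E₁.integrand (fun x => (1 - (4 * k / (1 + k) ^ 2) * x 0 ^ 2) *
      ((√(1 - x 0 ^ 2))⁻¹ * (√(1 - (4 * k / (1 + k) ^ 2) * x 0 ^ 2))⁻¹)) E₁.domain) :
    of R - of E₁ ∈ changeOfVariablesRel := by
  have hsq := BallPeeling.isSemialgebraic_posIoo
  obtain ⟨hk0, hk1⟩ := hk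
  have h1k : 0 < 1 + k := by linarith
  have hden : ∀ x : ℝ, 0 < 1 + k * x ^ 2 := fun x => by nlinarith [sq_nonneg x]
  have h1ka : IsAlgebraic ℚ (1 + k) := isAlgebraic_one.add hka
  -- continuity of the transformation on `ℝ`
  have hcont : Continuous fun x : ℝ => (1 + k) * x / (1 + k * x ^ 2) :=
    (continuous_const.mul continuous_id).div (continuous_const.add
      (continuous_const.mul (continuous_pow 2))) fun x => (hden x).ne'
  refine soloInformed_lift_mem_changeOfVariablesRel R E₁
    (g := fun x => (1 + k) * x / (1 + k * x ^ 2))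
    (g' := fun x => (1 + k) * (1 - k * x ^ 2) / (1 + k * x ^ 2) ^ 2)
    (S := Ioo (0:ℝ) 1) (T := Ioo (0:ℝ) 1) hRd hE₁d ?_ (fun t _ => ?_) ?_ ?_ ?_
  · -- semialgebraicity
    rw [hRd]
    refine IsSemialgebraicMapOn.of_forall hsq fun j => ?_
    have hq : IsSemialgebraicFunOn ℚ {x : Fin 1 → ℝ | x 0 ∈ Ioo (0:ℝ) 1}
        (fun x : Fin 1 → ℝ => 1 + k * x 0 ^ 2) :=
      ((isSemialgebraicFunOn_const_of_isAlgebraic hsq isAlgebraic_one).add_holds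
        ((isSemialgebraicFunOn_const_of_isAlgebraic hsq hka).mul_holds
          (isSemialgebraicFunOn_aeval hsq (MvPolynomial.X 0 ^ 2)))).congr fun x _ => by
        simp only [Pi.add_apply, Pi.mul_apply, map_pow, MvPolynomial.aeval_X]
    refine ((((isSemialgebraicFunOn_const_of_isAlgebraic hsq h1ka).mul_holds
      (isSemialgebraicFunOn_aeval hsq (MvPolynomial.X 0))).mul_holds
      (hq.inv fun x _ => (hden (x 0)).ne')).congr fun x _ => ?_)
    simp only [Pi.mul_apply, MvPolynomial.aeval_X, soloInformedLift, div_eq_mul_inv]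
  · -- derivative (quotient rule)
    have h1 : HasDerivAt (fun x : ℝ => (1 + k) * x) ((1 + k) * 1) t :=
      (hasDerivAt_id' t).const_mul (1 + k)
    have h2 : HasDerivAt (fun x : ℝ => 1 + k * x ^ 2) (k * (2 * t)) t := by
      simpa using ((soloInformed_hasDerivAt_sq t).const_mul k).const_add 1
    refine (h1.div h2 (hden t).ne').congr_deriv ?_
    field_simp
    ring
  · -- injectivity: `g a = g b ⇒ (a − b)(1 − kab) = 0`
    intro a ha b hb h
    have h' : (1 + k) * a / (1 + k * a ^ 2) = (1 + k) * b / (1 + k * b ^ 2) := h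
    rw [div_eq_div_iff (hden a).ne' (hden b).ne'] at h'
    have e : (1 + k) * ((a - b) * (1 - k * a * b)) = 0 := by linear_combination h'
    have hab : 0 < 1 - k * a * b := by
      have h1 : a * b < 1 := by
        have := mul_lt_mul_of_pos_right ha.2 hb.1
        linarith [hb.2]
      nlinarith [mul_pos ha.1 hb.1]
    rcases mul_eq_zero.1 e with e | e
    · linarith
    · rcases mul_eq_zero.1 e with e | e
      · linarith
      · linarith
  · -- image `= (0,1)` (intermediate values)
    ext y
    constructor
    · rintro ⟨x, hx, rfl⟩
      exact soloInformed_gauss_transformation_mem ⟨hk0, hk1⟩ hx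
    · intro hy
      have hg0 : (fun x : ℝ => (1 + k) * x / (1 + k * x ^ 2)) 0 = 0 := by simp
      have hg1 : (fun x : ℝ => (1 + k) * x / (1 + k * x ^ 2)) 1 = 1 := by
        simp only [one_pow, mul_one]
        exact div_self h1k.ne'
      have hyI : y ∈ Icc ((fun x : ℝ => (1 + k) * x / (1 + k * x ^ 2)) 0)
          ((fun x : ℝ => (1 + k) * x / (1 + k * x ^ 2)) 1) := by
        rw [hg0, hg1]; exact ⟨hy.1.le, hy.2.le⟩
      obtain ⟨x, hx, hgx⟩ := intermediate_value_Icc zero_le_one hcont.continuousOn hyI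
      refine ⟨x, ⟨lt_of_le_of_ne hx.1 ?_, lt_of_le_of_ne hx.2 ?_⟩, hgx⟩
      · rintro rfl
        rw [hg0] at hgx
        exact hy.1.ne hgx
      · rintro rfl
        rw [hg1] at hgx
        exact hy.2.ne' hgx
  · -- the integrand identity
    intro x hx
    have hs : x 0 ∈ Ioo (0:ℝ) 1 := by rw [hRd] at hx; exact hx
    have hy := soloInformed_gauss_transformation_mem ⟨hk0, hk1⟩ hs
    have hmem : soloInformedLift (fun x : ℝ => (1 + k) * x / (1 + k * x ^ 2)) x ∈ E₁.domain := by
      rw [hE₁d]; exact hy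
    have hd := hden (x 0)
    have hw0 : 0 < 1 - x 0 ^ 2 := by nlinarith [hs.1, hs.2]
    have hv0 : 0 < 1 - k ^ 2 * x 0 ^ 2 :=
      (soloInformed_legendre_radicand_pos hs (by nlinarith : k ^ 2 < 1)).2
    have hu0 : 0 < 1 - k * x 0 ^ 2 := by nlinarith [hs.1, hs.2, hk1, hk0]
    have hw : √(1 - x 0 ^ 2) ≠ 0 := (Real.sqrt_pos.2 hw0).ne'
    have hv : √(1 - k ^ 2 * x 0 ^ 2) ≠ 0 := (Real.sqrt_pos.2 hv0).ne'
    rw [hRi, hE₁i hmem]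
    simp only [soloInformedLift]
    have e1 : 1 - ((1 + k) * x 0 / (1 + k * x 0 ^ 2)) ^ 2 =
        ((1 - x 0 ^ 2) * (1 - k ^ 2 * x 0 ^ 2)) / (1 + k * x 0 ^ 2) ^ 2 := by
      field_simp
      ring
    have e2 : 1 - 4 * k / (1 + k) ^ 2 * ((1 + k) * x 0 / (1 + k * x 0 ^ 2)) ^ 2 =
        (1 - k * x 0 ^ 2) ^ 2 / (1 + k * x 0 ^ 2) ^ 2 := by
      field_simp
      ring
    rw [e1, e2, Real.sqrt_div' _ (sq_nonneg _), Real.sqrt_div' _ (sq_nonneg _),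
      Real.sqrt_sq hd.le, Real.sqrt_sq hu0.le, Real.sqrt_mul hw0.le,
      abs_of_pos (div_pos (mul_pos h1k hu0) (pow_pos hd 2))]
    field_simp

/-! ### The exact term of the second kind -/

/-- The primitive `F(x) = x·√((1−x²)(1−k²x²))/(1+kx²)` has derivative
`N(x)/(√((1−x²)(1−k²x²))·(1+kx²)²)`, `N = 1 − (2+k+2k²)x² + 3k²x⁴ + k³x⁶`, on `(0,1)`.
[this work] -/
theorem soloInformed_landenE_primitive_hasDerivAt {k : ℝ} (hk : k ∈ Ioo (0:ℝ) 1) {t : ℝ}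
    (ht : t ∈ Ioo (0:ℝ) 1) :
    HasDerivAt (fun s : ℝ => s * √((1 - s ^ 2) * (1 - k ^ 2 * s ^ 2)) / (1 + k * s ^ 2))
      ((1 - (2 + k + 2 * k ^ 2) * t ^ 2 + 3 * k ^ 2 * t ^ 4 + k ^ 3 * t ^ 6) /
        (√((1 - t ^ 2) * (1 - k ^ 2 * t ^ 2)) * (1 + k * t ^ 2) ^ 2)) t := by
  have hP0 : 0 < (1 - t ^ 2) * (1 - k ^ 2 * t ^ 2) := by
    have h := soloInformed_legendre_radicand_pos ht (by nlinarith [hk.1, hk.2] : k ^ 2 < 1)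
    exact mul_pos h.1 h.2
  have hden : 0 < 1 + k * t ^ 2 := by nlinarith [hk.1, sq_nonneg t]
  have hsP : √((1 - t ^ 2) * (1 - k ^ 2 * t ^ 2)) ≠ 0 := (Real.sqrt_pos.2 hP0).ne'
  have hsP2 : √((1 - t ^ 2) * (1 - k ^ 2 * t ^ 2)) ^ 2 = (1 - t ^ 2) * (1 - k ^ 2 * t ^ 2) :=
    Real.sq_sqrt hP0.le
  have hPd : HasDerivAt (fun s : ℝ => (1 - s ^ 2) * (1 - k ^ 2 * s ^ 2))
      (-(2 * t) * (1 - k ^ 2 * t ^ 2) + (1 - t ^ 2) * (-(k ^ 2 * (2 * t)))) t :=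
    ((soloInformed_hasDerivAt_sq t).const_sub 1).mul
      (((soloInformed_hasDerivAt_sq t).const_mul (k ^ 2)).const_sub 1)
  have hnum := (hasDerivAt_id' t).mul (hPd.sqrt hP0.ne')
  have hq : HasDerivAt (fun s : ℝ => 1 + k * s ^ 2) (k * (2 * t)) t := by
    simpa using ((soloInformed_hasDerivAt_sq t).const_mul k).const_add 1
  refine (hnum.div hq hden.ne').congr_deriv ?_
  simp only [Pi.mul_apply]
  set w := √((1 - t ^ 2) * (1 - k ^ 2 * t ^ 2)) with hw
  have hden' : (1 + k * t ^ 2) ≠ 0 := hden.ne'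
  have hden'' : (1 + t ^ 2 * k) ≠ 0 := by rw [mul_comm]; exact hden'
  rw [eq_div_iff (mul_ne_zero hsP (pow_ne_zero 2 hden'))]
  field_simp
  linear_combination (1 - t ^ 2 * k) * hsP2

/-- **The exact term is a relation.** For real algebraic `0 < k < 1` there is a representation
`X = [(0,1), N(x)/(√((1−x²)(1−k²x²))(1+kx²)²)]` with `⟦X⟧ = 0` in `P`: one Newton–Leibniz move
over the point with the primitive `F = x√((1−x²)(1−k²x²))/(1+kx²)`, `F(0) = F(1) = 0` (rule 3 on
`[0,1]`), the null boundary (rule 1a), and `[pt, 0] ∼ 0` (rule 1b). [this work] -/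
theorem soloInformed_landenE_exact (k : ℝ) (hk : k ∈ Ioo (0:ℝ) 1) (hka : IsAlgebraic ℚ k) :
    ∃ X : IntegralRep 1, X.domain = {x : Fin 1 → ℝ | x 0 ∈ Ioo (0:ℝ) 1} ∧
      EqOn X.integrand (fun x => (1 - (2 + k + 2 * k ^ 2) * x 0 ^ 2 + 3 * k ^ 2 * x 0 ^ 4 +
        k ^ 3 * x 0 ^ 6) / (√((1 - x 0 ^ 2) * (1 - k ^ 2 * x 0 ^ 2)) * (1 + k * x 0 ^ 2) ^ 2))
        X.domain ∧ of X ∈ relations := by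
  have hsq := BallPeeling.isSemialgebraic_posIoo
  obtain ⟨hk0, hk1⟩ := hk
  have hden : ∀ x : ℝ, 0 < 1 + k * x ^ 2 := fun x => by nlinarith [sq_nonneg x]
  have hk2a : IsAlgebraic ℚ (k ^ 2) := hka.pow 2
  have hμ : k ^ 2 ∈ Ioo (0:ℝ) 1 := ⟨by positivity, by nlinarith⟩
  -- the integrand on `ℝ`, extended by `0`
  set f : ℝ → ℝ := fun s => (1 - (2 + k + 2 * k ^ 2) * s ^ 2 + 3 * k ^ 2 * s ^ 4 + k ^ 3 * s ^ 6) /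
    (√((1 - s ^ 2) * (1 - k ^ 2 * s ^ 2)) * (1 + k * s ^ 2) ^ 2) with hfdef
  set g : ℝ → ℝ := fun s => if s ∈ Ioo (0:ℝ) 1 then f s else 0 with hgdef
  -- semialgebraicity of `f` on `(0,1)`
  have hq : IsSemialgebraicFunOn ℚ {x : Fin 1 → ℝ | x 0 ∈ Ioo (0:ℝ) 1}
      (fun x : Fin 1 → ℝ => 1 + k * x 0 ^ 2) :=
    ((isSemialgebraicFunOn_const_of_isAlgebraic hsq isAlgebraic_one).add_holds
      ((isSemialgebraicFunOn_const_of_isAlgebraic hsq hka).mul_holds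
        (isSemialgebraicFunOn_aeval hsq (MvPolynomial.X 0 ^ 2)))).congr fun x _ => by
      simp only [Pi.add_apply, Pi.mul_apply, map_pow, MvPolynomial.aeval_X]
  have hlin := (soloInformed_sa_modulusFactors hμ hk2a).1
  have hPsa : IsSemialgebraicFunOn ℚ {x : Fin 1 → ℝ | x 0 ∈ Ioo (0:ℝ) 1}
      (fun x : Fin 1 → ℝ => (1 - x 0 ^ 2) * (1 - k ^ 2 * x 0 ^ 2)) :=
    ((isSemialgebraicFunOn_aeval hsq (1 - MvPolynomial.X 0 ^ 2)).mul_holds hlin).congr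
      fun x _ => by simp only [Pi.mul_apply, map_sub, map_one, map_pow, MvPolynomial.aeval_X]
  have hNsa : IsSemialgebraicFunOn ℚ {x : Fin 1 → ℝ | x 0 ∈ Ioo (0:ℝ) 1}
      (fun x : Fin 1 → ℝ => 1 - (2 + k + 2 * k ^ 2) * x 0 ^ 2 + 3 * k ^ 2 * x 0 ^ 4 +
        k ^ 3 * x 0 ^ 6) := by
    have hc1 : IsAlgebraic ℚ (2 + k + 2 * k ^ 2) :=
      ((isAlgebraic_nat (R := ℚ) (A := ℝ) 2).add hka).add ((isAlgebraic_nat (R := ℚ) (A := ℝ) 2).mul hk2a)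
    have hc2 : IsAlgebraic ℚ (3 * k ^ 2) := (isAlgebraic_nat (R := ℚ) (A := ℝ) 3).mul hk2a
    have hc3 : IsAlgebraic ℚ (k ^ 3) := hka.pow 3
    refine ((((isSemialgebraicFunOn_const_of_isAlgebraic hsq isAlgebraic_one).sub_holds
      ((isSemialgebraicFunOn_const_of_isAlgebraic hsq hc1).mul_holds
        (isSemialgebraicFunOn_aeval hsq (MvPolynomial.X 0 ^ 2)))).add_holds
      ((isSemialgebraicFunOn_const_of_isAlgebraic hsq hc2).mul_holds
        (isSemialgebraicFunOn_aeval hsq (MvPolynomial.X 0 ^ 4)))).add_holds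
      ((isSemialgebraicFunOn_const_of_isAlgebraic hsq hc3).mul_holds
        (isSemialgebraicFunOn_aeval hsq (MvPolynomial.X 0 ^ 6)))).congr fun x _ => ?_
    simp only [Pi.add_apply, Pi.sub_apply, Pi.mul_apply, map_pow, MvPolynomial.aeval_X]
  have hf_sa : IsSemialgebraicFunOn ℚ {x : Fin 1 → ℝ | x 0 ∈ Ioo (0:ℝ) 1}
      (fun x : Fin 1 → ℝ => f (x 0)) := by
    refine ((hNsa.mul_holds (((IsSemialgebraicFunOn.sqrt_holds hPsa).mul_holds
      (hq.mul_holds hq)).inv fun x hx => ?_)).congr fun x _ => ?_)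
    · have hs : x 0 ∈ Ioo (0:ℝ) 1 := hx
      have hP0 : 0 < (1 - x 0 ^ 2) * (1 - k ^ 2 * x 0 ^ 2) := by
        have h := soloInformed_legendre_radicand_pos hs (by nlinarith : k ^ 2 < 1)
        exact mul_pos h.1 h.2
      simp only [Pi.mul_apply]
      exact mul_ne_zero (Real.sqrt_pos.2 hP0).ne' (mul_ne_zero (hden _).ne' (hden _).ne')
    · simp only [Pi.mul_apply, hfdef, div_eq_mul_inv, sq]
  have hg_sa : IsSemialgebraicFunOn ℚ {x : Fin 1 → ℝ | x 0 ∈ Icc (0:ℝ) 1}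
      (fun x : Fin 1 → ℝ => g (x 0)) := by
    refine isSemialgebraicFunOn_Icc_of_Ioo ?_ 0 0 (fun x hx => ?_) (fun x hx => ?_)
    · exact hf_sa.congr fun x hx => by
        have hx' : x 0 ∈ Ioo (0:ℝ) 1 := hx
        simp only [hgdef, if_pos hx']
    · have : x 0 ∉ Ioo (0:ℝ) 1 := fun h => by rw [hx] at h; exact lt_irrefl _ h.1
      simp only [hgdef, if_neg this, Rat.cast_zero]
    · have : x 0 ∉ Ioo (0:ℝ) 1 := fun h => by rw [hx] at h; exact lt_irrefl _ h.2
      simp only [hgdef, if_neg this, Rat.cast_zero]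
  -- integrability: `|f| ≤ 6·((1−x²)(1−k²x²))^{-1/2}`, the `K(k)` kernel
  obtain ⟨K, hKd, hKi⟩ := soloInformed_exists_ellipticK_rep (k ^ 2) hμ hk2a
  have hKint : IntegrableOn (fun s : ℝ => (√(1 - s ^ 2))⁻¹ * (√(1 - k ^ 2 * s ^ 2))⁻¹)
      (Ioo (0:ℝ) 1) := by
    have h := K.integrableOn
    rw [hKd, show K.integrand = fun x => (√(1 - x 0 ^ 2))⁻¹ * (√(1 - k ^ 2 * x 0 ^ 2))⁻¹ from
      funext hKi] at h
    exact integrableOn_setOf_apply_mem_iff.1 h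
  have hfint : IntegrableOn f (Ioo (0:ℝ) 1) := by
    refine Integrable.mono' (hKint.const_mul 6) ?_ ((ae_restrict_iff' measurableSet_Ioo).2
      (ae_of_all _ fun s hs => ?_))
    · exact (by rw [hfdef]; fun_prop : Measurable f).aestronglyMeasurable
    · have hw0 : 0 < 1 - s ^ 2 := by nlinarith [hs.1, hs.2]
      have hv0 : 0 < 1 - k ^ 2 * s ^ 2 :=
        (soloInformed_legendre_radicand_pos hs (by nlinarith : k ^ 2 < 1)).2
      have hd := hden s
      have hs2 : s ^ 2 ≤ 1 := by nlinarith [hs.1, hs.2]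
      have hs4 : s ^ 4 ≤ 1 := by nlinarith
      have hs6 : s ^ 6 ≤ 1 := by nlinarith
      have hN : |1 - (2 + k + 2 * k ^ 2) * s ^ 2 + 3 * k ^ 2 * s ^ 4 + k ^ 3 * s ^ 6| ≤ 6 := by
        have hc0 : 0 ≤ 2 + k + 2 * k ^ 2 := by positivity
        have h1 : 0 ≤ (2 + k + 2 * k ^ 2) * s ^ 2 := by positivity
        have h1' : (2 + k + 2 * k ^ 2) * s ^ 2 ≤ 5 :=
          (mul_le_mul_of_nonneg_left hs2 hc0).trans (by nlinarith)
        have h2 : 0 ≤ 3 * k ^ 2 * s ^ 4 := by positivity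
        have h2' : 3 * k ^ 2 * s ^ 4 ≤ 3 := by
          have : k ^ 2 * s ^ 4 ≤ 1 := mul_le_one₀ (by nlinarith) (by positivity) hs4
          nlinarith
        have h3 : 0 ≤ k ^ 3 * s ^ 6 := by positivity
        have h3' : k ^ 3 * s ^ 6 ≤ 1 :=
          mul_le_one₀ (pow_le_one₀ hk0.le hk1.le) (by positivity) hs6
        rw [abs_le]
        constructor <;> linarith
      have hsP : 0 < √((1 - s ^ 2) * (1 - k ^ 2 * s ^ 2)) := Real.sqrt_pos.2 (mul_pos hw0 hv0)
      have hsq1 : 1 ≤ (1 + k * s ^ 2) ^ 2 := by nlinarith [mul_nonneg hk0.le (sq_nonneg s)]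
      rw [hfdef, Real.norm_eq_abs, abs_div, abs_of_pos (mul_pos hsP (pow_pos hd 2)),
        Real.sqrt_mul hw0.le, div_le_iff₀ (by positivity)]
      have hww : 0 < √(1 - s ^ 2) := Real.sqrt_pos.2 hw0
      have hvv : 0 < √(1 - k ^ 2 * s ^ 2) := Real.sqrt_pos.2 hv0
      rw [show 6 * ((√(1 - s ^ 2))⁻¹ * (√(1 - k ^ 2 * s ^ 2))⁻¹) *
          (√(1 - s ^ 2) * √(1 - k ^ 2 * s ^ 2) * (1 + k * s ^ 2) ^ 2) = 6 * (1 + k * s ^ 2) ^ 2 *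
          (((√(1 - s ^ 2))⁻¹ * √(1 - s ^ 2)) * ((√(1 - k ^ 2 * s ^ 2))⁻¹ * √(1 - k ^ 2 * s ^ 2)))
          by ring, inv_mul_cancel₀ hww.ne', inv_mul_cancel₀ hvv.ne', mul_one, mul_one]
      nlinarith
  have hgi : IntegrableOn g (Icc (0:ℝ) 1) := by
    rw [integrableOn_Icc_iff_integrableOn_Ioo]
    exact hfint.congr_fun (fun s hs => by simp only [hgdef, if_pos hs]) measurableSet_Ioo
  -- the band representation `D = [[0,1], g]`
  obtain ⟨D, hDd, hDi⟩ : ∃ D : IntegralRep 1, D.domain = {x : Fin 1 → ℝ | x 0 ∈ Icc (0:ℝ) 1} ∧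
      D.integrand = fun x => g (x 0) :=
    ⟨⟨_, _, isSemialgebraic_setOf_apply_mem_Icc, hg_sa, integrableOn_setOf_apply_mem_iff.2 hgi⟩,
      rfl, rfl⟩
  -- the primitive
  have hIcc := isSemialgebraic_setOf_apply_mem_Icc
  have hF_sa : IsSemialgebraicFunOn ℚ {x : Fin 1 → ℝ | x 0 ∈ Icc (0:ℝ) 1}
      (fun z : Fin 1 → ℝ => z 0 * √((1 - z 0 ^ 2) * (1 - k ^ 2 * z 0 ^ 2)) / (1 + k * z 0 ^ 2)) := by
    have hqc : IsSemialgebraicFunOn ℚ {x : Fin 1 → ℝ | x 0 ∈ Icc (0:ℝ) 1}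
        (fun x : Fin 1 → ℝ => 1 + k * x 0 ^ 2) :=
      ((isSemialgebraicFunOn_const_of_isAlgebraic hIcc isAlgebraic_one).add_holds
        ((isSemialgebraicFunOn_const_of_isAlgebraic hIcc hka).mul_holds
          (isSemialgebraicFunOn_aeval hIcc (MvPolynomial.X 0 ^ 2)))).congr fun x _ => by
        simp only [Pi.add_apply, Pi.mul_apply, map_pow, MvPolynomial.aeval_X]
    have hPc : IsSemialgebraicFunOn ℚ {x : Fin 1 → ℝ | x 0 ∈ Icc (0:ℝ) 1}
        (fun x : Fin 1 → ℝ => (1 - x 0 ^ 2) * (1 - k ^ 2 * x 0 ^ 2)) :=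
      ((isSemialgebraicFunOn_aeval hIcc (1 - MvPolynomial.X 0 ^ 2)).mul_holds
        ((isSemialgebraicFunOn_const_of_isAlgebraic hIcc isAlgebraic_one).sub_holds
          ((isSemialgebraicFunOn_const_of_isAlgebraic hIcc hk2a).mul_holds
            (isSemialgebraicFunOn_aeval hIcc (MvPolynomial.X 0 ^ 2))))).congr fun x _ => by
        simp only [Pi.mul_apply, Pi.sub_apply, map_sub, map_one, map_pow, MvPolynomial.aeval_X]
    refine ((((isSemialgebraicFunOn_aeval hIcc (MvPolynomial.X 0)).mul_holds
      (IsSemialgebraicFunOn.sqrt_holds hPc)).mul_holds (hqc.inv fun x _ => (hden _).ne')).congr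
      fun x _ => ?_)
    simp only [Pi.mul_apply, MvPolynomial.aeval_X, div_eq_mul_inv]
  set U := IntegralRep.unit.constMul (0:ℝ) isAlgebraic_zero with hU
  have hUd : U.domain = univ := by rw [hU, IntegralRep.domain_constMul, IntegralRep.unit_domain]
  have hNL : of D - of U ∈ newtonLeibnizRel := by
    refine ⟨0, D, U, fun _ => ((0:ℕ):ℝ), fun _ => ((0:ℕ):ℝ) + 1,
      fun z => z (Fin.last 0) * √((1 - z (Fin.last 0) ^ 2) * (1 - k ^ 2 * z (Fin.last 0) ^ 2)) /
        (1 + k * z (Fin.last 0) ^ 2),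
      by rw [hDd]; exact hF_sa, by rw [hUd]; exact isSemialgebraicFunOn_natCast isSemialgebraic_univ 0,
      ?_, fun _ _ => by simp, ?_, ?_, ?_, ?_, rfl⟩
    · rw [hUd]
      exact (isSemialgebraicFunOn_aeval isSemialgebraic_univ
        (((0:ℕ) : MvPolynomial (Fin 0) ℚ) + 1)).congr fun x _ => by simp
    · rw [hDd, hUd]
      ext z
      simp only [mem_univ, true_and, mem_setOf_eq, mem_Icc, Nat.cast_zero, zero_add]
      rfl
    · intro x _
      simp only [Fin.snoc_last, Nat.cast_zero, zero_add]
      have hc1 : Continuous fun t : ℝ => (1 - t ^ 2) * (1 - k ^ 2 * t ^ 2) := by fun_prop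
      have hc2 : Continuous fun t : ℝ => 1 + k * t ^ 2 := by fun_prop
      exact ((continuous_id'.mul hc1.sqrt).div hc2 fun t => (hden t).ne').continuousOn
    · intro x _ t ht
      simp only [Nat.cast_zero, zero_add] at ht
      simp only [Fin.snoc_last, hDi]
      rw [show (0 : Fin 1) = Fin.last 0 from rfl, Fin.snoc_last]
      have hgt : g t = f t := by simp only [hgdef, if_pos ht]
      rw [hgt, hfdef]
      exact soloInformed_landenE_primitive_hasDerivAt ⟨hk0, hk1⟩ ht
    · intro x _
      simp only [hU, IntegralRep.integrand_constMul, IntegralRep.unit_integrand, Fin.snoc_last,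
        Nat.cast_zero, zero_add, one_pow, sub_self, zero_mul, mul_one, zero_div,
        mul_zero, Real.sqrt_zero]
  have hD_mem : of D - of U ∈ relations := newtonLeibnizRel_subset_relations hNL
  -- `[pt, 0] ∼ 0`
  have hU_mem : of U ∈ relations := by
    have h : of U - of U - of U ∈ relations :=
      integrandAddRel_subset_relations ⟨0, U, U, U, rfl, rfl, fun z _ => by
        simp [hU, IntegralRep.integrand_constMul], rfl⟩
    have e : of U = -(of U - of U - of U) := by abel
    rw [e]
    exact relations.neg_mem h
  -- the open restriction
  have hsub : {x : Fin 1 → ℝ | x 0 ∈ Ioo (0:ℝ) 1} ⊆ D.domain := by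
    rw [hDd]
    exact fun x hx => ⟨hx.1.le, hx.2.le⟩
  have hvol : volume (D.domain \ {x : Fin 1 → ℝ | x 0 ∈ Ioo (0:ℝ) 1}) = 0 := by
    rw [hDd]; exact volume_setOf_Icc_diff_Ioo
  refine ⟨D.restrict _ hsq hsub, rfl, fun x hx => ?_, ?_⟩
  · have hx' : x 0 ∈ Ioo (0:ℝ) 1 := hx
    show D.integrand x = _
    rw [hDi]
    simp only [hgdef, if_pos hx', hfdef]
  · have h1 : of D - of (D.restrict _ hsq hsub) ∈ relations :=
      D.of_sub_of_restrict_mem_relations hsq hsub hvol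
    have e : of (D.restrict _ hsq hsub) = (of D - of U) + of U - (of D - of (D.restrict _ hsq hsub)) := by
      abel
    rw [e]
    exact relations.sub_mem (relations.add_mem hD_mem hU_mem) h1

end Summit.KontsevichZagierPeriods.KontsevichZagierPeriods.Theorems

end
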